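import Summits.ValiantsHypothesis.ValiantsHypothesis.Theorems.LacunarySymmetroidMatrixDescartesCensusDoorA34NodeChambersComplex

/-!
# `MatrixDescartes` census — DOOR A at `(3,4)`: the PAIR CHART for the complex-node classes R2 and R0 — one cubic
# `F_ε = ab(a+b) − ε₁u²b − ε₂v²a` for all three node classes

HONEST FRAMING.  Object-search cell `pub-symmetroid`, door-A seat `val-sym-door-p3` (g9); item stmt-ValiantsHypothesis-19980
`DoorA34 = PosRootLawAt 3 4 18` (route item `Theses.LacunarySymmetroid.DoorA34`) is OPEN and asserted nowhere in this file.
Companion of `…CensusDoorA34NodePairChart` (class R4: `4W²·det = ab(a+b) − u²b − v²a`) and `…CensusDoorA34NodeChambersComplex`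
(`det_R2_eq`, `det_R0_eq`).  The same cubic with a sign vector `ε = (ε₁, ε₂)` carries the complex-node classes:

* `R2_chart_identity`, **`det_R2_pairChart`** — class R2 (`ε = (+,−)`): with `Γ = D_r² + D_s²` (`D_r = det(v₀;v₁;r)`,
  `D_s = det(v₀;v₁;s)`), `a = D₀²ℓ₀ + D₁²ℓ₁`, `u = D₀²ℓ₀ − D₁²ℓ₁` (`Dᵢ = det(vᵢ;r;s)`), `b = −4D₀²D₁²·B/Γ²`, `v = 4D₀²D₁²·J/Γ²`
  (`B = m_R(D_r²−D_s²) − 2m_I D_r D_s`, `J = m_I(D_r²−D_s²) + 2m_R D_r D_s`, so `B² + J² = Γ²|m|²`):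
  `16 D₀⁴D₁⁴ · det M = −Γ² · (ab(a+b) − u²b + v²a)`.
* `R0_chart_identity`, **`det_R0_pairChart`** — class R0 (`ε = (−,−)`), division-free: with `Γ₁ = A₁² + B₁²`, `Γ₂ = A₂² + B₂²`
  (the cofactor pairs of `det_R0_eq`), `p = Γ₁²·Q₂`, `q = Γ₁²·J₂`, `r = Γ₂²·Q₁`, `s = Γ₂²·J₁` (`Qᵢ` the two test values, `Jᵢ` their
  conjugate partners): `Γ₁⁴Γ₂⁴ · det M = −(p(r² + s²) + r(p² + q²))`, i.e. `−F_{(−,−)}/8` in `a = 2p, u = 2q, b = 2r, v = 2s`.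

So, with `…NodePairChart`: for every node class the determinant of a generic `(3,4)` real symmetric pencil is, up to a non-zero
constant, `F_ε(a,b,u,v) = ab(a+b) − ε₁u²b − ε₂v²a` for a basis `(a,b,u,v)` of the node-nomial space and `ε = (+,+), (+,−), (−,−)`
for R4, R2, R0 (memo `NODE-CHAMBERS-g9.md` §7).  Nothing here bounds `ζ_sym(3,4)`; `DoorA34` stays OPEN; nothing bears on
`MatrixDescartes` (stmt-ValiantsHypothesis-18050) or on `VP ≠ VNP`.  [folklore] `ring` / `field_simp` identities.
-/

-- `Summit.ValiantsHypothesis.ValiantsHypothesis.…` repeats a component by the D-0017 layout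
-- (single-conjunct summit), which the `dupNamespace` linter flags; the name is mandated.
set_option linter.dupNamespace false

namespace Summit.ValiantsHypothesis.ValiantsHypothesis.Theorems.LacunarySymmetroidMatrixDescartes.Census

open Finset
open scoped BigOperators Matrix

/-! ## Class R2 -/

/-- **R2 chart identity** (abstract form of `det_R2_eq`'s right-hand side). [folklore] -/
theorem R2_chart_identity (ℓ₀ ℓ₁ mR mI D₀ D₁ Dr Ds : ℝ) (hΓ : Dr ^ 2 + Ds ^ 2 ≠ 0) :
    16 * D₀ ^ 4 * D₁ ^ 4 *
        (ℓ₀ * ℓ₁ * (mR * (Dr ^ 2 - Ds ^ 2) - 2 * mI * (Dr * Ds)) - (mR ^ 2 + mI ^ 2) * (ℓ₀ * D₀ ^ 2 + ℓ₁ * D₁ ^ 2))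
      = -(Dr ^ 2 + Ds ^ 2) ^ 2 *
        ((D₀ ^ 2 * ℓ₀ + D₁ ^ 2 * ℓ₁) * (-4 * D₀ ^ 2 * D₁ ^ 2 * (mR * (Dr ^ 2 - Ds ^ 2) - 2 * mI * (Dr * Ds)) / (Dr ^ 2 + Ds ^ 2) ^ 2)
            * ((D₀ ^ 2 * ℓ₀ + D₁ ^ 2 * ℓ₁)
              + (-4 * D₀ ^ 2 * D₁ ^ 2 * (mR * (Dr ^ 2 - Ds ^ 2) - 2 * mI * (Dr * Ds)) / (Dr ^ 2 + Ds ^ 2) ^ 2))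
          - (D₀ ^ 2 * ℓ₀ - D₁ ^ 2 * ℓ₁) ^ 2
            * (-4 * D₀ ^ 2 * D₁ ^ 2 * (mR * (Dr ^ 2 - Ds ^ 2) - 2 * mI * (Dr * Ds)) / (Dr ^ 2 + Ds ^ 2) ^ 2)
          + (4 * D₀ ^ 2 * D₁ ^ 2 * (mI * (Dr ^ 2 - Ds ^ 2) + 2 * mR * (Dr * Ds)) / (Dr ^ 2 + Ds ^ 2) ^ 2) ^ 2
            * (D₀ ^ 2 * ℓ₀ + D₁ ^ 2 * ℓ₁)) := by
  have hΓ2 : (Dr ^ 2 + Ds ^ 2) ^ 2 ≠ 0 := pow_ne_zero 2 hΓ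
  field_simp
  ring

/-- **R2 PAIR CHART.**  For `M = ℓ₀ v₀v₀ᵀ + ℓ₁ v₁v₁ᵀ + m_R (rrᵀ − ssᵀ) − m_I (rsᵀ + srᵀ)` with `D_r² + D_s² ≠ 0`:
`16 D₀⁴D₁⁴ · det M = −Γ² · (ab(a+b) − u²b + v²a)` in the coordinates of the module docstring (`ε = (+,−)`). [folklore] -/
theorem det_R2_pairChart (v₀ v₁ r s : Fin 3 → ℝ) (ℓ₀ ℓ₁ mR mI : ℝ) (D₀ D₁ Dr Ds : ℝ)
    (hD₀ : D₀ = v₀ 0 * (r 1 * s 2 - r 2 * s 1) - v₀ 1 * (r 0 * s 2 - r 2 * s 0) + v₀ 2 * (r 0 * s 1 - r 1 * s 0))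
    (hD₁ : D₁ = v₁ 0 * (r 1 * s 2 - r 2 * s 1) - v₁ 1 * (r 0 * s 2 - r 2 * s 0) + v₁ 2 * (r 0 * s 1 - r 1 * s 0))
    (hDr : Dr = v₀ 0 * (v₁ 1 * r 2 - v₁ 2 * r 1) - v₀ 1 * (v₁ 0 * r 2 - v₁ 2 * r 0) + v₀ 2 * (v₁ 0 * r 1 - v₁ 1 * r 0))
    (hDs : Ds = v₀ 0 * (v₁ 1 * s 2 - v₁ 2 * s 1) - v₀ 1 * (v₁ 0 * s 2 - v₁ 2 * s 0) + v₀ 2 * (v₁ 0 * s 1 - v₁ 1 * s 0))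
    (hΓ : Dr ^ 2 + Ds ^ 2 ≠ 0) :
    16 * D₀ ^ 4 * D₁ ^ 4 *
        (ℓ₀ • Matrix.vecMulVec v₀ v₀ + ℓ₁ • Matrix.vecMulVec v₁ v₁
          + mR • (Matrix.vecMulVec r r - Matrix.vecMulVec s s) - mI • (Matrix.vecMulVec r s + Matrix.vecMulVec s r)).det
      = -(Dr ^ 2 + Ds ^ 2) ^ 2 *
        ((D₀ ^ 2 * ℓ₀ + D₁ ^ 2 * ℓ₁) * (-4 * D₀ ^ 2 * D₁ ^ 2 * (mR * (Dr ^ 2 - Ds ^ 2) - 2 * mI * (Dr * Ds)) / (Dr ^ 2 + Ds ^ 2) ^ 2)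
            * ((D₀ ^ 2 * ℓ₀ + D₁ ^ 2 * ℓ₁)
              + (-4 * D₀ ^ 2 * D₁ ^ 2 * (mR * (Dr ^ 2 - Ds ^ 2) - 2 * mI * (Dr * Ds)) / (Dr ^ 2 + Ds ^ 2) ^ 2))
          - (D₀ ^ 2 * ℓ₀ - D₁ ^ 2 * ℓ₁) ^ 2
            * (-4 * D₀ ^ 2 * D₁ ^ 2 * (mR * (Dr ^ 2 - Ds ^ 2) - 2 * mI * (Dr * Ds)) / (Dr ^ 2 + Ds ^ 2) ^ 2)
          + (4 * D₀ ^ 2 * D₁ ^ 2 * (mI * (Dr ^ 2 - Ds ^ 2) + 2 * mR * (Dr * Ds)) / (Dr ^ 2 + Ds ^ 2) ^ 2) ^ 2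
            * (D₀ ^ 2 * ℓ₀ + D₁ ^ 2 * ℓ₁)) := by
  rw [det_R2_eq, ← hD₀, ← hD₁, ← hDr, ← hDs, ← R2_chart_identity ℓ₀ ℓ₁ mR mI D₀ D₁ Dr Ds hΓ]

/-! ## Class R0 -/

/-- **R0 chart identity** (abstract form of `det_R0_eq`'s right-hand side; division-free). [folklore] -/
theorem R0_chart_identity (lR lI mR mI A₁ B₁ A₂ B₂ : ℝ) :
    (A₁ ^ 2 + B₁ ^ 2) ^ 4 * (A₂ ^ 2 + B₂ ^ 2) ^ 4 *
        (-(mR ^ 2 + mI ^ 2) * (lR * (A₂ ^ 2 - B₂ ^ 2) - 2 * lI * (A₂ * B₂))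
          - (lR ^ 2 + lI ^ 2) * (mR * (A₁ ^ 2 - B₁ ^ 2) - 2 * mI * (A₁ * B₁)))
      = -(((A₁ ^ 2 + B₁ ^ 2) ^ 2 * (lR * (A₂ ^ 2 - B₂ ^ 2) - 2 * lI * (A₂ * B₂))) *
            (((A₂ ^ 2 + B₂ ^ 2) ^ 2 * (mR * (A₁ ^ 2 - B₁ ^ 2) - 2 * mI * (A₁ * B₁))) ^ 2
              + ((A₂ ^ 2 + B₂ ^ 2) ^ 2 * (mI * (A₁ ^ 2 - B₁ ^ 2) + 2 * mR * (A₁ * B₁))) ^ 2)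
          + ((A₂ ^ 2 + B₂ ^ 2) ^ 2 * (mR * (A₁ ^ 2 - B₁ ^ 2) - 2 * mI * (A₁ * B₁))) *
            (((A₁ ^ 2 + B₁ ^ 2) ^ 2 * (lR * (A₂ ^ 2 - B₂ ^ 2) - 2 * lI * (A₂ * B₂))) ^ 2
              + ((A₁ ^ 2 + B₁ ^ 2) ^ 2 * (lI * (A₂ ^ 2 - B₂ ^ 2) + 2 * lR * (A₂ * B₂))) ^ 2)) := by
  ring

/-- **R0 PAIR CHART.**  For `M = N(ℓ; p,q) + N(m; r,s)` (two conjugate node pairs), with the cofactors `A₁, B₁, A₂, B₂` of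
`det_R0_eq` named by the hypotheses: `Γ₁⁴Γ₂⁴ · det M = −(p'(r'² + s'²) + r'(p'² + q'²))` with `p' = Γ₁²Q₂`, `q' = Γ₁²J₂`,
`r' = Γ₂²Q₁`, `s' = Γ₂²J₁` (`ε = (−,−)`: `F = ab(a+b) + u²b + v²a` in `a = 2p', u = 2q', b = 2r', v = 2s'`, up to `−1/8`). [folklore] -/
theorem det_R0_pairChart (p q r s : Fin 3 → ℝ) (lR lI mR mI : ℝ) (A₁ B₁ A₂ B₂ : ℝ)
    (hA₁ : A₁ = p 0 * (q 1 * r 2 - q 2 * r 1) - p 1 * (q 0 * r 2 - q 2 * r 0) + p 2 * (q 0 * r 1 - q 1 * r 0))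
    (hB₁ : B₁ = p 0 * (q 1 * s 2 - q 2 * s 1) - p 1 * (q 0 * s 2 - q 2 * s 0) + p 2 * (q 0 * s 1 - q 1 * s 0))
    (hA₂ : A₂ = r 0 * (s 1 * p 2 - s 2 * p 1) - r 1 * (s 0 * p 2 - s 2 * p 0) + r 2 * (s 0 * p 1 - s 1 * p 0))
    (hB₂ : B₂ = r 0 * (s 1 * q 2 - s 2 * q 1) - r 1 * (s 0 * q 2 - s 2 * q 0) + r 2 * (s 0 * q 1 - s 1 * q 0)) :
    (A₁ ^ 2 + B₁ ^ 2) ^ 4 * (A₂ ^ 2 + B₂ ^ 2) ^ 4 *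
        (lR • (Matrix.vecMulVec p p - Matrix.vecMulVec q q) - lI • (Matrix.vecMulVec p q + Matrix.vecMulVec q p)
          + mR • (Matrix.vecMulVec r r - Matrix.vecMulVec s s) - mI • (Matrix.vecMulVec r s + Matrix.vecMulVec s r)).det
      = -(((A₁ ^ 2 + B₁ ^ 2) ^ 2 * (lR * (A₂ ^ 2 - B₂ ^ 2) - 2 * lI * (A₂ * B₂))) *
            (((A₂ ^ 2 + B₂ ^ 2) ^ 2 * (mR * (A₁ ^ 2 - B₁ ^ 2) - 2 * mI * (A₁ * B₁))) ^ 2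
              + ((A₂ ^ 2 + B₂ ^ 2) ^ 2 * (mI * (A₁ ^ 2 - B₁ ^ 2) + 2 * mR * (A₁ * B₁))) ^ 2)
          + ((A₂ ^ 2 + B₂ ^ 2) ^ 2 * (mR * (A₁ ^ 2 - B₁ ^ 2) - 2 * mI * (A₁ * B₁))) *
            (((A₁ ^ 2 + B₁ ^ 2) ^ 2 * (lR * (A₂ ^ 2 - B₂ ^ 2) - 2 * lI * (A₂ * B₂))) ^ 2
              + ((A₁ ^ 2 + B₁ ^ 2) ^ 2 * (lI * (A₂ ^ 2 - B₂ ^ 2) + 2 * lR * (A₂ * B₂))) ^ 2)) := by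
  rw [det_R0_eq, ← hA₁, ← hB₁, ← hA₂, ← hB₂]
  exact R0_chart_identity lR lI mR mI A₁ B₁ A₂ B₂

end Summit.ValiantsHypothesis.ValiantsHypothesis.Theorems.LacunarySymmetroidMatrixDescartes.Census
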